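import Summits.QuantumFields.BalabanUV.T4Continuum.Support.B13StepOfRecordSub
import Summits.QuantumFields.BalabanUV.T4Continuum.Support.B13StepEnvelopeEndArithmetic

/-!
# NE5 ∕ U3 — E9 ∕ E9[rec] RE-POINTED OVER AN ARBITRARY OPERATOR CARRIER (owner RULING R20, journal `CLAIMS.log` l.11032): the
# CAUCHY (fibre-envelope) END FACE on the assembled step model over `Op`, on the carriers of record over `Op`, and FOR THE SLOTS OF
# RECORD ON A SUB-SLOT `M ≤ OpDatum E` — conclusion literally `T4OutputRate.NE5 (B13StepOfRecord.outA S₀ E₀ cB) (B13StepOfRecord.outB S₀ E₀ cB) W κ θ′ C₅`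
# with the operator half of W2 quantifying over the ball IN `↥M × Hist`

Cell `pub-balaban`, unit `b2b-balaban-t4-ne5-formalise-leaf-03` (NE5 formalisation swarm, LEAF PROVER 03, gen 6; the one-line re-point of
this lineage's E9∕E9[rec] `Support/B13StepEnvelopeEnd.lean` p214842 asked for by R20, on the companions `Support/B13RepresentsOn.lean` ∕
`Support/B13StepOfRecordSub.lean`).  Summits-side NEW WORK under the LEAN PLACEMENT RULE (cell bookkeeping; NOT a Literature module; no
owner END-face module is edited — the tree's END `T4InputCauchyRateTermwise.ne5_at_of_stepModel_fibreCl₂_scale_nat` is applied BY NAME).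
HONEST FRAMING: rung (B)+1 of the FINITE-VOLUME T⁴ continuum programme — NOT infinite volume, NOT a mass gap, NOT the Clay problem, and
**NOT A PROOF OF NE5**: every END below is an IMPLICATION whose wall binders — W2-op = `ActOpLineAnalyticOn` (GAPS G-ne5p1-1′∕1″, NOT
PRINTED), the per-activity norm majorant ((2.38) KIND) with its per-domain budget or its decay split + anchored norm, W1, W4, the one-run
slice budgets (W3 KIND), the quoted levels L05∕L06 ([Balaban1987RG1] (1.18) p. 263 SHAPE), the transport reading, the numerics — are
DISPLAYED HYPOTHESES, asserted nowhere (c3∕c4∕c6).  HONEST DEPENDENCY (cell line, verbatim): continuum YM on T⁴ ⇐ BetaPertH ∧ nine spine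
estimates (0/9 proved); BetaPertH ⇐ (D1) ∧ (D4) ∧ CAP+tail; G-an2-4 gates asym, D1 and NE2/3/4.

WHY (R20).  On `Op := OpDatum E = ℓ^∞(E)` with `x`-indexed potential species the factor-level binder `hact : ActOpLineAnalyticOn …` of
E9[rec] (p214842) quantifies over operator directions with non-measurable `x`-sections (G-ne5p2-5).  The END producers are polymorphic in
`Op`; re-pointed to the model over a sub-slot `M` CONTAINING THE DATA OF RECORD the binder quantifies over directions IN `M` only
(`B13StepOfRecordSub.mem_ballClass_onSub_iff`), and for the cores of record read through the inclusion the conclusion is about the SAME two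
functionals `B13StepOfRecord.outA∕outB S₀ E₀ cB` (`outA_restrict`∕`outB_restrict`, `rfl`).
* §1 **`ne5_of_assemblyOn_envelope_opRate`** — E9 on `AssemblyOn.stepOn 𝔄 (𝔄.bHist E₀ cB)` over any `Op` (binder list and constant of
  p214842's `ne5_of_assembly_envelope_opRate`); **`ne5_of_assemblyOn_envelope_reading`** — W1 PRODUCED along a norm-non-contracting reading
  `rd : Op →L[ℂ] OpDatum E` from row NE2's entry currency (`AssemblyOn.operatorRate_of_reading`).
* §2 **`ne5_of_recordOn_envelope_actNormDecay`** — E9[rec] on `B13StepOfRecordSub.stepOn S E₀ cB` (carriers of record, any `Op`), per-domain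
  budget DISCHARGED from the decay split + anchored norm by leaf-01's `actBudget_record_of_actNormDecay`.
* §3 **`ne5_of_record_onSub_envelope_actNormDecay`** (cores ON `↥M`; W1 from row NE2's entry currency OF RECORD along `M.subtypeL`; reading ∕
  slice budgets ∕ W4 stated ON THE MODEL OF RECORD — they transfer by `Iff.rfl`); **`ne5_of_record_restrict_envelope_actNormDecay`** (cores :=
  `S₀.act` through the inclusion): root `NE5 (B13StepOfRecord.outA S₀ E₀ cB) (B13StepOfRecord.outB S₀ E₀ cB) W κ θ′ C₅`, E9[rec]'s constant
  VERBATIM — E9[rec] RE-POINTED (R20); **`exists_ne5_of_record_restrict_envelope_actNormDecay`** — letters `ρ₀, k₀, B` ELIMINATED (leaf-10's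
  `reach_elim_iff`∕`reach_binders_exists`∕`smallness_of_gain`, as in p214993); **`exists_ne5_of_record_restrict_envelope_readAt`** — THE
  MOST-REDUCED CAUCHY FACE OF RECORD OVER THE SUB-SLOT (slot package read at transport, `transportReads_record_readAt`: no reading, no letter).
Nothing is asserted about [II]'s kernels ∕ potentials ∕ terms.  0 sorry; axioms ⊆ {propext, Classical.choice, Quot.sound}.
-/

noncomputable section

open scoped BigOperators
open Metric Set
namespace Summit.QuantumFields.BalabanUV.T4Continuum.B13StepEnvelopeEndSub

open Literature.MathematicalPhysics.QuantumFieldTheory.Balaban1983to89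
open Literature.MathematicalPhysics.QuantumFieldTheory.Balaban1983to89.T4OutputRate (Carriers Functional DecayBound NE5)
open Literature.MathematicalPhysics.QuantumFieldTheory.Balaban1983to89.T4InputCauchyRateData (StepModel)
open Literature.MathematicalPhysics.QuantumFieldTheory.Balaban1983to89.T4InputCauchyRateSpecies (ballClass)
open Literature.MathematicalPhysics.QuantumFieldTheory.Balaban1983to89.T4InputCauchyRateTermwise (ne5_at_of_stepModel_fibreCl₂_scale_nat)
open Summit.QuantumFields.BalabanUV.T4Continuum.B13Carriers (TwoRuns)
open Summit.QuantumFields.BalabanUV.T4Continuum.B13OpDatum (Format OpDatum)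
open Summit.QuantumFields.BalabanUV.T4Continuum.B13OpDatumJunctions (opOf RawBounded WeightedEntrywiseRate)
open Summit.QuantumFields.BalabanUV.T4Continuum.B13StepTermLabels (TermIdx InnerLabel)
open Summit.QuantumFields.BalabanUV.T4Continuum.B13StepTermFamily (ActData ActExpLinearOn)
open Summit.QuantumFields.BalabanUV.T4Continuum.B13StepTermSocket (labelsIndexing touchInc)
open Summit.QuantumFields.BalabanUV.T4Continuum.B13InnerData (Bnd b13InnerData)
open Summit.QuantumFields.BalabanUV.T4Continuum.B13TermRep (actMajorant)
open Summit.QuantumFields.BalabanUV.T4Continuum.UrsellTreeSum (ind)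
open Summit.QuantumFields.BalabanUV.T4Continuum.UrsellTermBudget (actSum)
open Summit.QuantumFields.BalabanUV.T4Continuum.B13Base (selfCtr)
open Summit.QuantumFields.BalabanUV.T4Continuum.B13DomainGeometryTR (SCube footprint domainGeometry)
open Summit.QuantumFields.BalabanUV.T4Continuum.B13RepresentsOn (AssemblyOn)
open Summit.QuantumFields.BalabanUV.T4Continuum.B13StepOfRecord (Slots assembly step)
open Summit.QuantumFields.BalabanUV.T4Continuum.B13StepOfRecordSub (SlotsOn assemblyOn stepOn outA outB onSub restrict)
open Summit.QuantumFields.BalabanUV.T4Continuum.B13StepOfRecordActNorm (actBudget_record_of_actNormDecay)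
open Summit.QuantumFields.BalabanUV.T4Continuum.B13TermOpEnvelope (ActOpLineAnalyticOn fibreEnvelopesCl_b13_of_act)
open Summit.QuantumFields.BalabanUV.T4Continuum.B13StepEndArithmetic (reach_elim_iff smallness_of_gain)
open Summit.QuantumFields.BalabanUV.T4Continuum.OutputRateArithmetic (reach_binders_exists)
open Summit.QuantumFields.BalabanUV.T4Continuum.B13StepOfRecordReadAt (readAtSlots transportReads_record_readAt)

/-! ## §1 The Cauchy END face on the assembled step model over an arbitrary operator carrier -/

section Assembled

variable {C : Carriers} {Op IOp Hist ι P J Ω : Type*} [NormedAddCommGroup Op] [NormedSpace ℂ Op] [NormedAddCommGroup Hist]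
  [NormedSpace ℂ Hist] [MeasurableSpace Ω] (𝔄 : AssemblyOn C Op IOp Hist ι P J)

/-- [folklore] **E9 OVER AN ARBITRARY OPERATOR CARRIER, W1 IN MARGIN UNITS.**  For `𝔄.stepOn (𝔄.bHist E₀ cB)` (`𝔄 : AssemblyOn C Op …`):
the transport READING; the DISPLAYED one-run slice budgets of both runs (W3 KIND); the quoted levels L05∕L06; W1 as `OperatorRate δ θ` and
W4 as `InsertionRate … δ′ θ`; ROOM `rOp ≤ ROp`, `bHist + rHist ≤ RHist`; the DISPLAYED per-activity norm majorant `A` on the ball class in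
`Op × Hist` ((2.38) KIND) with per-domain budget `G·e^{−κd(X)}` ((2.41)∕[26] KIND); **W2 at ACTIVITY level: `ActOpLineAnalyticOn` (operator
half, directions in `Op` — [analysis], displayed) and `ActExpLinearOn` (history half, STRUCTURE)**; and E1's numerics IMPLY
`NE5 outA outB W κ θ′ ((G∕(1−ρ₀)·δ + G∕(1−ρ₀)·δ′ + B)(θ′ − ω)∕(θ′ − (ω + G∕(1−ρ₀)·cA)))` — `fibreEnvelopesCl_b13_of_act` + the tree's
`ne5_at_of_stepModel_fibreCl₂_scale_nat` with MI-R, L03, L09 and the insertion structure DISCHARGED.  NOT a proof of NE5. -/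
theorem ne5_of_assemblyOn_envelope_opRate {W : Set (ℕ → ℝ)} {ROp RHist : ℕ → ℝ} {A : ℕ → (ℕ → ℝ) → C.BgB → P → J → ℝ}
    {Dt : ActData P J Op Hist Ω} {κ G EA₀ E₀ E₁ cA cB δ δ' θ θ' ρ₀ B : ℝ} {k₀ : ℕ}
    (hT : 𝔄.TransportReads W)
    (hbB : 𝔄.SliceBudgetB W κ cB) (hbA : 𝔄.D.SliceBudget (𝔄.stepOn (𝔄.bHist E₀ cB)) W κ cA)
    (hdA : DecayBound (𝔄.outA (𝔄.bHist E₀ cB)) W EA₀ κ) (hdB : DecayBound (𝔄.outB (𝔄.bHist E₀ cB)) W E₀ κ)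
    (hop : (𝔄.stepOn (𝔄.bHist E₀ cB)).OperatorRate W δ θ) (hins : (𝔄.stepOn (𝔄.bHist E₀ cB)).InsertionRate W κ E₀ δ' θ)
    (hOp : ∀ k, 𝔄.rOp k ≤ ROp k) (hHist : ∀ k, 𝔄.bHist E₀ cB k + 𝔄.rHist k ≤ RHist k)
    (hA : ∀ k, ∀ g ∈ W, ∀ (U : C.BgB) (q : Op × Hist), q ∈ ballClass (selfCtr 𝔄.raw 𝔄.histRef) ROp RHist k g U →
      ∀ X : C.Dom, C.scale X = k → ∀ i, 𝔄.𝒯.Rel k i X → ∀ m,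
        ‖𝔄.act (𝔄.𝒯.poly i m) (𝔄.𝒯.lab i m) q.1 q.2‖ ≤ A k g U (𝔄.𝒯.poly i m) (𝔄.𝒯.lab i m))
    (hbud : ∀ k, ∀ g ∈ W, ∀ (U : C.BgB) (X : C.Dom), C.scale X = k →
      Summable (actMajorant 𝔄.𝒯 𝔄.inc (A k g U) k X) ∧
        ∑' i, actMajorant 𝔄.𝒯 𝔄.inc (A k g U) k X i ≤ G * Real.exp (-(κ * C.d X)))
    (hact : ActOpLineAnalyticOn 𝔄.𝒯 𝔄.act (ballClass (selfCtr 𝔄.raw 𝔄.histRef) ROp RHist) W)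
    (hexp : ActExpLinearOn 𝔄.𝒯 𝔄.act Dt (ballClass (selfCtr 𝔄.raw 𝔄.histRef) ROp RHist) W)
    (hE₀ : 0 ≤ E₀) (hE₁ : 0 < E₁) (hG : 0 ≤ G) (hcA : 0 ≤ cA) (hcB : 0 ≤ cB) (hδ : 0 ≤ δ) (hδ' : 0 ≤ δ')
    (hθ : 0 ≤ θ) (hθθ' : θ ≤ θ') (hθ'1 : θ' ≤ 1) (hω : 0 < 𝔄.D.ω) (hω1 : 𝔄.D.ω < 1) (hρ₀ : ρ₀ < 1)
    (hnear : (δ + δ') * θ ^ k₀ + cA * (EA₀ + E₀) / (1 - 𝔄.D.ω) ≤ ρ₀) (hB : 0 ≤ B)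
    (hfirst : ∀ k < k₀, EA₀ + E₀ ≤ B * θ ^ k) (hsmall : 𝔄.D.ω + G / (1 - ρ₀) * cA < θ') :
    NE5 (𝔄.outA (𝔄.bHist E₀ cB)) (𝔄.outB (𝔄.bHist E₀ cB)) W κ θ'
      ((G / (1 - ρ₀) * δ + G / (1 - ρ₀) * δ' + B) * (θ' - 𝔄.D.ω) / (θ' - (𝔄.D.ω + G / (1 - ρ₀) * cA))) := by
  obtain ⟨hopF, hhistF⟩ := fibreEnvelopesCl_b13_of_act 𝔄.𝒯 𝔄.inc 𝔄.act (M := 𝔄.stepOn (𝔄.bHist E₀ cB)) (fun _ _ _ _ => rfl)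
    (𝔄.boxInClass _ W hOp hHist) hA hbud hact hexp
  exact ne5_at_of_stepModel_fibreCl₂_scale_nat (𝔄.representsA _ hT) (𝔄.representsB _ W)
    (AssemblyOn.inBase hbB hdB hE₀ hcB hω.le hω1) hopF hhistF hdA hdB hop hins (𝔄.insAffine _ W) (𝔄.insBlind _ W)
    (𝔄.insHomog _ W) (AssemblyOn.insScaleBound hbA hω.le hE₁.le) hE₁ hG hG hδ hδ' hθ hθθ' hθ'1 hcA hω hρ₀ hnear hB hfirst hsmall

/-- [folklore] **E9 OVER AN ARBITRARY OPERATOR CARRIER, W1 ALONG A READING** (R20: «W1 readings transfer along `rd`»): the same with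
`OperatorRate (c₁∕r₀) θ` PRODUCED from row NE2's DISPLAYED weighted entrywise two-run species rate `c₁·θ^k` (bounded raw suppliers, margin
floor `r₀`) along a norm-non-contracting reading `rd : Op →L[ℂ] OpDatum E` under which the operator data ARE `opOf F rawA`∕`opOf F rawB`. -/
theorem ne5_of_assemblyOn_envelope_reading {E : Type*} (rd : Op →L[ℂ] OpDatum E) (hrd : ∀ z : Op, ‖z‖ ≤ ‖rd z‖)
    {F : ℕ → Format E} {rawA : (ℕ → ℝ) → C.BgA → ℕ → E → ℂ} {rawB : (ℕ → ℝ) → C.BgB → ℕ → E → ℂ}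
    (hrdA : ∀ g V k, rd (𝔄.opA g V k) = opOf F rawA g V k) (hrdB : ∀ g U k, rd (𝔄.opB g U k) = opOf F rawB g U k)
    {W : Set (ℕ → ℝ)} {ROp RHist : ℕ → ℝ} {A : ℕ → (ℕ → ℝ) → C.BgB → P → J → ℝ}
    {Dt : ActData P J Op Hist Ω} {κ G EA₀ E₀ E₁ cA cB c₁ r₀ δ' θ θ' ρ₀ B : ℝ} {k₀ : ℕ}
    (hT : 𝔄.TransportReads W)
    (hbB : 𝔄.SliceBudgetB W κ cB) (hbA : 𝔄.D.SliceBudget (𝔄.stepOn (𝔄.bHist E₀ cB)) W κ cA)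
    (hdA : DecayBound (𝔄.outA (𝔄.bHist E₀ cB)) W EA₀ κ) (hdB : DecayBound (𝔄.outB (𝔄.bHist E₀ cB)) W E₀ κ)
    (hRA : RawBounded F (fun g U k => rawA g (C.transport U) k) W) (hRB : RawBounded F rawB W)
    (hwer : WeightedEntrywiseRate F (fun g U k => rawA g (C.transport U) k) rawB W c₁ fun k => θ ^ k)
    (hfl : ∀ k, r₀ ≤ 𝔄.rOp k) (hins : (𝔄.stepOn (𝔄.bHist E₀ cB)).InsertionRate W κ E₀ δ' θ)
    (hOp : ∀ k, 𝔄.rOp k ≤ ROp k) (hHist : ∀ k, 𝔄.bHist E₀ cB k + 𝔄.rHist k ≤ RHist k)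
    (hA : ∀ k, ∀ g ∈ W, ∀ (U : C.BgB) (q : Op × Hist), q ∈ ballClass (selfCtr 𝔄.raw 𝔄.histRef) ROp RHist k g U →
      ∀ X : C.Dom, C.scale X = k → ∀ i, 𝔄.𝒯.Rel k i X → ∀ m,
        ‖𝔄.act (𝔄.𝒯.poly i m) (𝔄.𝒯.lab i m) q.1 q.2‖ ≤ A k g U (𝔄.𝒯.poly i m) (𝔄.𝒯.lab i m))
    (hbud : ∀ k, ∀ g ∈ W, ∀ (U : C.BgB) (X : C.Dom), C.scale X = k →
      Summable (actMajorant 𝔄.𝒯 𝔄.inc (A k g U) k X) ∧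
        ∑' i, actMajorant 𝔄.𝒯 𝔄.inc (A k g U) k X i ≤ G * Real.exp (-(κ * C.d X)))
    (hact : ActOpLineAnalyticOn 𝔄.𝒯 𝔄.act (ballClass (selfCtr 𝔄.raw 𝔄.histRef) ROp RHist) W)
    (hexp : ActExpLinearOn 𝔄.𝒯 𝔄.act Dt (ballClass (selfCtr 𝔄.raw 𝔄.histRef) ROp RHist) W)
    (hE₀ : 0 ≤ E₀) (hE₁ : 0 < E₁) (hG : 0 ≤ G) (hcA : 0 ≤ cA) (hcB : 0 ≤ cB) (hc₁ : 0 ≤ c₁) (hr₀ : 0 < r₀)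
    (hδ' : 0 ≤ δ') (hθ : 0 ≤ θ) (hθθ' : θ ≤ θ') (hθ'1 : θ' ≤ 1) (hω : 0 < 𝔄.D.ω) (hω1 : 𝔄.D.ω < 1) (hρ₀ : ρ₀ < 1)
    (hnear : (c₁ / r₀ + δ') * θ ^ k₀ + cA * (EA₀ + E₀) / (1 - 𝔄.D.ω) ≤ ρ₀) (hB : 0 ≤ B)
    (hfirst : ∀ k < k₀, EA₀ + E₀ ≤ B * θ ^ k) (hsmall : 𝔄.D.ω + G / (1 - ρ₀) * cA < θ') :
    NE5 (𝔄.outA (𝔄.bHist E₀ cB)) (𝔄.outB (𝔄.bHist E₀ cB)) W κ θ'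
      ((G / (1 - ρ₀) * (c₁ / r₀) + G / (1 - ρ₀) * δ' + B) * (θ' - 𝔄.D.ω) / (θ' - (𝔄.D.ω + G / (1 - ρ₀) * cA))) :=
  ne5_of_assemblyOn_envelope_opRate 𝔄 hT hbB hbA hdA hdB
    (AssemblyOn.operatorRate_of_reading (BHist := 𝔄.bHist E₀ cB) rd hrd hrdA hrdB hRA hRB hwer hc₁ hθ hfl hr₀) hins hOp hHist hA
    hbud hact hexp hE₀ hE₁ hG hcA hcB (div_nonneg hc₁ hr₀.le) hδ' hθ hθθ' hθ'1 hω hω1 hρ₀ hnear hB hfirst hsmall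

end Assembled

/-! ## §2 The Cauchy END face on the carriers of record over an arbitrary operator carrier -/

section RecordOn

variable {G : Type} [GaugeGroup G] {R : TwoRuns G} {Op IOp Hist Ω : Type*} [NormedAddCommGroup Op] [NormedSpace ℂ Op]
  [NormedAddCommGroup Hist] [NormedSpace ℂ Hist] [MeasurableSpace Ω] (S : SlotsOn R Op IOp Hist) (E₀ cB : ℝ)

/-- [folklore] **E9[rec] OVER AN ARBITRARY OPERATOR CARRIER, W1 IN MARGIN UNITS.**  §1 at the assembly of record over `Op`
(`B13StepOfRecordSub.assemblyOn S`) with the per-domain budget binder DISCHARGED from the factorwise DECAY SPLIT `A ≤ A′·e^{−κ(d(Z)+5)}` and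
the ANCHORED exponential norm `Φ′` of `A′` with `36Φ′ < 1` (leaf-01's THEOREM `actBudget_record_of_actNormDecay` — locality, reach ν = 9,
(2.27) c = 5 on the carriers of record); conclusion `NE5 (outA S E₀ cB) (outB S E₀ cB) W κ θ′ C₅` with E9[rec]'s constant,
`G := Φ′∕(1 − 36Φ′)`.  NOT a proof of NE5. -/
theorem ne5_of_recordOn_envelope_actNormDecay {W : Set (ℕ → ℝ)} {ROp RHist : ℕ → ℝ}
    {A A' : ℕ → (ℕ → ℝ) → R.carriers.BgB → R.carriers.Dom → InnerLabel R.carriers.Dom (Bnd R) → ℝ}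
    {Dt : ActData R.carriers.Dom (InnerLabel R.carriers.Dom (Bnd R)) Op Hist Ω}
    {κ Φ' EA₀ E₁ cA δ δ' θ θ' ρ₀ B : ℝ} {k₀ : ℕ}
    (hT : (assemblyOn S).TransportReads W)
    (hbB : (assemblyOn S).SliceBudgetB W κ cB) (hbA : S.D.SliceBudget (stepOn S E₀ cB) W κ cA)
    (hdA : DecayBound (outA S E₀ cB) W EA₀ κ) (hdB : DecayBound (outB S E₀ cB) W E₀ κ)
    (hop : (stepOn S E₀ cB).OperatorRate W δ θ) (hins : (stepOn S E₀ cB).InsertionRate W κ E₀ δ' θ)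
    (hOp : ∀ k, S.rOp k ≤ ROp k) (hHist : ∀ k, (assemblyOn S).bHist E₀ cB k + S.rHist k ≤ RHist k)
    (hA : ∀ k, ∀ g ∈ W, ∀ (U : R.carriers.BgB) (q : Op × Hist),
      q ∈ ballClass (selfCtr (assemblyOn S).raw (assemblyOn S).histRef) ROp RHist k g U → ∀ X : R.carriers.Dom,
        R.carriers.scale X = k → ∀ i : TermIdx R.carriers.Dom (Bnd R), (labelsIndexing (domainGeometry R) (b13InnerData R)).Rel k i X →
          ∀ m, ‖S.act ((labelsIndexing (domainGeometry R) (b13InnerData R)).poly i m)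
              ((labelsIndexing (domainGeometry R) (b13InnerData R)).lab i m) q.1 q.2‖ ≤
            A k g U ((labelsIndexing (domainGeometry R) (b13InnerData R)).poly i m)
              ((labelsIndexing (domainGeometry R) (b13InnerData R)).lab i m))
    (hA0 : ∀ k g U Z ℓ, 0 ≤ A k g U Z ℓ) (hA0' : ∀ k g U Z ℓ, 0 ≤ A' k g U Z ℓ) (hκ : 0 ≤ κ)
    (hdec : ∀ k g U Z ℓ, A k g U Z ℓ ≤ A' k g U Z ℓ * Real.exp (-(κ * (R.carriers.d Z + 5))))
    (hΦ0 : 0 ≤ Φ') (hΦsmall : 36 * Φ' < 1)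
    (hΦ : ∀ k, ∀ g ∈ W, ∀ (U : R.carriers.BgB) (q : SCube R),
      ∑ Z ∈ R.domAt k, ind (q ∈ footprint Z) * actSum (b13InnerData R) (A' k g U) k Z * Real.exp ((footprint Z).card) ≤ Φ')
    (hact : ActOpLineAnalyticOn (labelsIndexing (domainGeometry R) (b13InnerData R)) S.act
      (ballClass (selfCtr (assemblyOn S).raw (assemblyOn S).histRef) ROp RHist) W)
    (hexp : ActExpLinearOn (labelsIndexing (domainGeometry R) (b13InnerData R)) S.act Dt
      (ballClass (selfCtr (assemblyOn S).raw (assemblyOn S).histRef) ROp RHist) W)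
    (hE₀ : 0 ≤ E₀) (hE₁ : 0 < E₁) (hcA : 0 ≤ cA) (hcB : 0 ≤ cB) (hδ : 0 ≤ δ) (hδ' : 0 ≤ δ')
    (hθ : 0 ≤ θ) (hθθ' : θ ≤ θ') (hθ'1 : θ' ≤ 1) (hω : 0 < S.D.ω) (hω1 : S.D.ω < 1) (hρ₀ : ρ₀ < 1)
    (hnear : (δ + δ') * θ ^ k₀ + cA * (EA₀ + E₀) / (1 - S.D.ω) ≤ ρ₀) (hB : 0 ≤ B)
    (hfirst : ∀ k < k₀, EA₀ + E₀ ≤ B * θ ^ k) (hsmall : S.D.ω + Φ' / (1 - 36 * Φ') / (1 - ρ₀) * cA < θ') :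
    NE5 (outA S E₀ cB) (outB S E₀ cB) W κ θ'
      ((Φ' / (1 - 36 * Φ') / (1 - ρ₀) * δ + Φ' / (1 - 36 * Φ') / (1 - ρ₀) * δ' + B) * (θ' - S.D.ω) /
        (θ' - (S.D.ω + Φ' / (1 - 36 * Φ') / (1 - ρ₀) * cA))) :=
  ne5_of_assemblyOn_envelope_opRate (assemblyOn S) hT hbB hbA hdA hdB hop hins hOp hHist hA
    (actBudget_record_of_actNormDecay hκ hA0 hA0' hdec hΦ0 hΦsmall hΦ) hact hexp hE₀ hE₁ (div_nonneg hΦ0 (by linarith)) hcA hcB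
    hδ hδ' hθ hθθ' hθ'1 hω hω1 hρ₀ hnear hB hfirst hsmall

end RecordOn

/-! ## §3 E9[rec] FOR THE SLOTS OF RECORD ON A SUB-SLOT CONTAINING THE DATA OF RECORD (R20's re-point) -/

section OnSub

variable {G : Type} [GaugeGroup G] {R : TwoRuns G} {E IOp Hist Ω : Type*} [NormedAddCommGroup Hist] [NormedSpace ℂ Hist]
  [MeasurableSpace Ω] (S₀ : Slots R E IOp Hist) (M : Submodule ℂ (OpDatum E))
  (hMA : ∀ g V k, opOf S₀.F S₀.rawA g V k ∈ M) (hMB : ∀ g U k, opOf S₀.F S₀.rawB g U k ∈ M)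
  (act : R.carriers.Dom → InnerLabel R.carriers.Dom (Bnd R) → M → Hist → ℂ) (E₀ cB : ℝ)

/-- [folklore] **E9[rec] FOR THE SLOTS OF RECORD ON THE SUB-SLOT `M`, CORES TYPED ON `↥M`** (`B13StepOfRecordSub.onSub S₀ M hMA hMB act`):
the transport READING and the displayed run-B slice budget OF THE ASSEMBLY OF RECORD, the run-A slice budget and W4 OF THE MODEL OF
RECORD (all transfer by `Iff.rfl`), the quoted levels for the sub-slot model's outputs, W1 PRODUCED from row NE2's entry currency OF
RECORD (`c₁·θ^k`, bounded raw suppliers, margin floor `r₀`) along `M.subtypeL`, ROOM, the per-activity norm majorant `A` of `act` on the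
sub-slot ball class (a family of subsets of `↥M × Hist` — `mem_ballClass_onSub_iff`) with its decay split and anchored norm, **`ActOpLineAnalyticOn`
for `act` over directions IN `M`** and `ActExpLinearOn`, and the numerics IMPLY `NE5 (outA (onSub …) E₀ cB) (outB (onSub …) E₀ cB) W κ θ′ C₅`
with E9[rec]'s constant verbatim.  NOT a proof of NE5. -/
theorem ne5_of_record_onSub_envelope_actNormDecay {W : Set (ℕ → ℝ)} {ROp RHist : ℕ → ℝ}
    {A A' : ℕ → (ℕ → ℝ) → R.carriers.BgB → R.carriers.Dom → InnerLabel R.carriers.Dom (Bnd R) → ℝ}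
    {Dt : ActData R.carriers.Dom (InnerLabel R.carriers.Dom (Bnd R)) M Hist Ω}
    {κ Φ' EA₀ E₁ cA c₁ r₀ δ' θ θ' ρ₀ B : ℝ} {k₀ : ℕ}
    (hT : (assembly S₀).TransportReads W)
    (hbB : (assembly S₀).SliceBudgetB W κ cB) (hbA : S₀.D.SliceBudget (step S₀ E₀ cB) W κ cA)
    (hdA : DecayBound (outA (onSub S₀ M hMA hMB act) E₀ cB) W EA₀ κ)
    (hdB : DecayBound (outB (onSub S₀ M hMA hMB act) E₀ cB) W E₀ κ)
    (hRA : RawBounded S₀.F (assembly S₀).rawAt W) (hRB : RawBounded S₀.F S₀.rawB W)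
    (hwer : WeightedEntrywiseRate S₀.F (assembly S₀).rawAt S₀.rawB W c₁ fun k => θ ^ k) (hfl : ∀ k, r₀ ≤ S₀.rOp k)
    (hins : (step S₀ E₀ cB).InsertionRate W κ E₀ δ' θ)
    (hOp : ∀ k, S₀.rOp k ≤ ROp k) (hHist : ∀ k, (assembly S₀).bHist E₀ cB k + S₀.rHist k ≤ RHist k)
    (hA : ∀ k, ∀ g ∈ W, ∀ (U : R.carriers.BgB) (q : M × Hist),
      q ∈ ballClass (selfCtr (assemblyOn (onSub S₀ M hMA hMB act)).raw (assemblyOn (onSub S₀ M hMA hMB act)).histRef) ROp RHist k g U →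
        ∀ X : R.carriers.Dom, R.carriers.scale X = k → ∀ i : TermIdx R.carriers.Dom (Bnd R),
          (labelsIndexing (domainGeometry R) (b13InnerData R)).Rel k i X → ∀ m,
            ‖act ((labelsIndexing (domainGeometry R) (b13InnerData R)).poly i m)
                ((labelsIndexing (domainGeometry R) (b13InnerData R)).lab i m) q.1 q.2‖ ≤
              A k g U ((labelsIndexing (domainGeometry R) (b13InnerData R)).poly i m)
                ((labelsIndexing (domainGeometry R) (b13InnerData R)).lab i m))
    (hA0 : ∀ k g U Z ℓ, 0 ≤ A k g U Z ℓ) (hA0' : ∀ k g U Z ℓ, 0 ≤ A' k g U Z ℓ) (hκ : 0 ≤ κ)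
    (hdec : ∀ k g U Z ℓ, A k g U Z ℓ ≤ A' k g U Z ℓ * Real.exp (-(κ * (R.carriers.d Z + 5))))
    (hΦ0 : 0 ≤ Φ') (hΦsmall : 36 * Φ' < 1)
    (hΦ : ∀ k, ∀ g ∈ W, ∀ (U : R.carriers.BgB) (q : SCube R),
      ∑ Z ∈ R.domAt k, ind (q ∈ footprint Z) * actSum (b13InnerData R) (A' k g U) k Z * Real.exp ((footprint Z).card) ≤ Φ')
    (hact : ActOpLineAnalyticOn (labelsIndexing (domainGeometry R) (b13InnerData R)) act
      (ballClass (selfCtr (assemblyOn (onSub S₀ M hMA hMB act)).raw (assemblyOn (onSub S₀ M hMA hMB act)).histRef) ROp RHist) W)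
    (hexp : ActExpLinearOn (labelsIndexing (domainGeometry R) (b13InnerData R)) act Dt
      (ballClass (selfCtr (assemblyOn (onSub S₀ M hMA hMB act)).raw (assemblyOn (onSub S₀ M hMA hMB act)).histRef) ROp RHist) W)
    (hE₀ : 0 ≤ E₀) (hE₁ : 0 < E₁) (hcA : 0 ≤ cA) (hcB : 0 ≤ cB) (hc₁ : 0 ≤ c₁) (hr₀ : 0 < r₀) (hδ' : 0 ≤ δ')
    (hθ : 0 ≤ θ) (hθθ' : θ ≤ θ') (hθ'1 : θ' ≤ 1) (hω : 0 < S₀.D.ω) (hω1 : S₀.D.ω < 1) (hρ₀ : ρ₀ < 1)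
    (hnear : (c₁ / r₀ + δ') * θ ^ k₀ + cA * (EA₀ + E₀) / (1 - S₀.D.ω) ≤ ρ₀) (hB : 0 ≤ B)
    (hfirst : ∀ k < k₀, EA₀ + E₀ ≤ B * θ ^ k) (hsmall : S₀.D.ω + Φ' / (1 - 36 * Φ') / (1 - ρ₀) * cA < θ') :
    NE5 (outA (onSub S₀ M hMA hMB act) E₀ cB) (outB (onSub S₀ M hMA hMB act) E₀ cB) W κ θ'
      ((Φ' / (1 - 36 * Φ') / (1 - ρ₀) * (c₁ / r₀) + Φ' / (1 - 36 * Φ') / (1 - ρ₀) * δ' + B) * (θ' - S₀.D.ω) /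
        (θ' - (S₀.D.ω + Φ' / (1 - 36 * Φ') / (1 - ρ₀) * cA))) :=
  ne5_of_recordOn_envelope_actNormDecay (onSub S₀ M hMA hMB act) E₀ cB
    ((B13StepOfRecordSub.transportReads_onSub_iff S₀ M hMA hMB act W).2 hT)
    ((B13StepOfRecordSub.sliceBudgetB_onSub_iff S₀ M hMA hMB act W κ cB).2 hbB)
    ((B13StepOfRecordSub.sliceBudget_onSub_iff S₀ M hMA hMB act E₀ cB W κ cA).2 hbA) hdA hdB
    (B13StepOfRecordSub.operatorRate_onSub_of_weightedEntrywise S₀ M hMA hMB act E₀ cB hRA hRB hwer hc₁ hθ hfl hr₀)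
    ((B13StepOfRecordSub.insertionRate_onSub_iff S₀ M hMA hMB act E₀ cB W κ E₀ δ' θ).2 hins) hOp hHist hA hA0 hA0' hκ hdec
    hΦ0 hΦsmall hΦ hact hexp hE₀ hE₁ hcA hcB (div_nonneg hc₁ hr₀.le) hδ' hθ hθθ' hθ'1 hω hω1 hρ₀ hnear hB hfirst hsmall

/-- [folklore] **E9[rec] RE-POINTED (R20): THE SLOTS OF RECORD RESTRICTED TO A SUB-SLOT `M ∋` THE DATA OF RECORD — SAME ROOT, SAME
LETTERS, OPERATOR-BALL BINDERS OVER `↥M`.**  For `S₀ : B13StepOfRecord.Slots R E IOp Hist` and a ℂ-submodule `M ≤ OpDatum E` containing both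
runs' operator data of record: EXACTLY the displayed binder list of `B13StepEnvelopeEnd.ne5_of_record_envelope_actNormDecay` (p214842) —
reading, slice budgets, the quoted levels L05∕L06 for `B13StepOfRecord.outA∕outB S₀ E₀ cB`, W1 in row NE2's entry currency, W4, room,
majorant + decay split + anchored norm, numerics — EXCEPT that the per-activity majorant, **`ActOpLineAnalyticOn`** and `ActExpLinearOn`
are stated for the cores `S₀.act` READ THROUGH THE INCLUSION on the sub-slot ball class (directions IN `M`: satisfiable in principle for
`x`-indexed cores when `M := measOp`, G-ne5p2-5∕R20); conclusion literally
`NE5 (B13StepOfRecord.outA S₀ E₀ cB) (B13StepOfRecord.outB S₀ E₀ cB) W κ θ′ C₅` with E9[rec]'s `C₅` (`outA_restrict`∕`outB_restrict`, `rfl`).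
NOT a proof of NE5: an implication from displayed binders. -/
theorem ne5_of_record_restrict_envelope_actNormDecay {W : Set (ℕ → ℝ)} {ROp RHist : ℕ → ℝ}
    {A A' : ℕ → (ℕ → ℝ) → R.carriers.BgB → R.carriers.Dom → InnerLabel R.carriers.Dom (Bnd R) → ℝ}
    {Dt : ActData R.carriers.Dom (InnerLabel R.carriers.Dom (Bnd R)) M Hist Ω}
    {κ Φ' EA₀ E₁ cA c₁ r₀ δ' θ θ' ρ₀ B : ℝ} {k₀ : ℕ}
    (hT : (assembly S₀).TransportReads W)
    (hbB : (assembly S₀).SliceBudgetB W κ cB) (hbA : S₀.D.SliceBudget (step S₀ E₀ cB) W κ cA)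
    (hdA : DecayBound (B13StepOfRecord.outA S₀ E₀ cB) W EA₀ κ) (hdB : DecayBound (B13StepOfRecord.outB S₀ E₀ cB) W E₀ κ)
    (hRA : RawBounded S₀.F (assembly S₀).rawAt W) (hRB : RawBounded S₀.F S₀.rawB W)
    (hwer : WeightedEntrywiseRate S₀.F (assembly S₀).rawAt S₀.rawB W c₁ fun k => θ ^ k) (hfl : ∀ k, r₀ ≤ S₀.rOp k)
    (hins : (step S₀ E₀ cB).InsertionRate W κ E₀ δ' θ)
    (hOp : ∀ k, S₀.rOp k ≤ ROp k) (hHist : ∀ k, (assembly S₀).bHist E₀ cB k + S₀.rHist k ≤ RHist k)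
    (hA : ∀ k, ∀ g ∈ W, ∀ (U : R.carriers.BgB) (q : M × Hist),
      q ∈ ballClass (selfCtr (assemblyOn (restrict S₀ M hMA hMB)).raw (assemblyOn (restrict S₀ M hMA hMB)).histRef) ROp RHist k g U →
        ∀ X : R.carriers.Dom, R.carriers.scale X = k → ∀ i : TermIdx R.carriers.Dom (Bnd R),
          (labelsIndexing (domainGeometry R) (b13InnerData R)).Rel k i X → ∀ m,
            ‖S₀.act ((labelsIndexing (domainGeometry R) (b13InnerData R)).poly i m)
                ((labelsIndexing (domainGeometry R) (b13InnerData R)).lab i m) (q.1 : OpDatum E) q.2‖ ≤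
              A k g U ((labelsIndexing (domainGeometry R) (b13InnerData R)).poly i m)
                ((labelsIndexing (domainGeometry R) (b13InnerData R)).lab i m))
    (hA0 : ∀ k g U Z ℓ, 0 ≤ A k g U Z ℓ) (hA0' : ∀ k g U Z ℓ, 0 ≤ A' k g U Z ℓ) (hκ : 0 ≤ κ)
    (hdec : ∀ k g U Z ℓ, A k g U Z ℓ ≤ A' k g U Z ℓ * Real.exp (-(κ * (R.carriers.d Z + 5))))
    (hΦ0 : 0 ≤ Φ') (hΦsmall : 36 * Φ' < 1)
    (hΦ : ∀ k, ∀ g ∈ W, ∀ (U : R.carriers.BgB) (q : SCube R),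
      ∑ Z ∈ R.domAt k, ind (q ∈ footprint Z) * actSum (b13InnerData R) (A' k g U) k Z * Real.exp ((footprint Z).card) ≤ Φ')
    (hact : ActOpLineAnalyticOn (labelsIndexing (domainGeometry R) (b13InnerData R)) (restrict S₀ M hMA hMB).act
      (ballClass (selfCtr (assemblyOn (restrict S₀ M hMA hMB)).raw (assemblyOn (restrict S₀ M hMA hMB)).histRef) ROp RHist) W)
    (hexp : ActExpLinearOn (labelsIndexing (domainGeometry R) (b13InnerData R)) (restrict S₀ M hMA hMB).act Dt
      (ballClass (selfCtr (assemblyOn (restrict S₀ M hMA hMB)).raw (assemblyOn (restrict S₀ M hMA hMB)).histRef) ROp RHist) W)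
    (hE₀ : 0 ≤ E₀) (hE₁ : 0 < E₁) (hcA : 0 ≤ cA) (hcB : 0 ≤ cB) (hc₁ : 0 ≤ c₁) (hr₀ : 0 < r₀) (hδ' : 0 ≤ δ')
    (hθ : 0 ≤ θ) (hθθ' : θ ≤ θ') (hθ'1 : θ' ≤ 1) (hω : 0 < S₀.D.ω) (hω1 : S₀.D.ω < 1) (hρ₀ : ρ₀ < 1)
    (hnear : (c₁ / r₀ + δ') * θ ^ k₀ + cA * (EA₀ + E₀) / (1 - S₀.D.ω) ≤ ρ₀) (hB : 0 ≤ B)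
    (hfirst : ∀ k < k₀, EA₀ + E₀ ≤ B * θ ^ k) (hsmall : S₀.D.ω + Φ' / (1 - 36 * Φ') / (1 - ρ₀) * cA < θ') :
    NE5 (B13StepOfRecord.outA S₀ E₀ cB) (B13StepOfRecord.outB S₀ E₀ cB) W κ θ'
      ((Φ' / (1 - 36 * Φ') / (1 - ρ₀) * (c₁ / r₀) + Φ' / (1 - 36 * Φ') / (1 - ρ₀) * δ' + B) * (θ' - S₀.D.ω) /
        (θ' - (S₀.D.ω + Φ' / (1 - 36 * Φ') / (1 - ρ₀) * cA))) :=
  ne5_of_record_onSub_envelope_actNormDecay S₀ M hMA hMB (fun Z ℓ o h => S₀.act Z ℓ (o : OpDatum E) h) E₀ cB hT hbB hbA hdA hdB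
    hRA hRB hwer hfl hins hOp hHist hA hA0 hA0' hκ hdec hΦ0 hΦsmall hΦ hact hexp hE₀ hE₁ hcA hcB hc₁ hr₀ hδ' hθ hθθ' hθ'1 hω hω1 hρ₀
    hnear hB hfirst hsmall

/-- [folklore] **E9[rec] RE-POINTED, ARITHMETIC LETTERS ELIMINATED** — `ne5_of_record_restrict_envelope_actNormDecay` with its binders over
`ρ₀, k₀, B` REPLACED by `0 < θ < 1` and the two strict size inequalities `cA(EA₀ + E₀) < 1 − ω`,
`ω + (Φ′∕(1 − 36Φ′))·cA·(1 − ω)∕(1 − ω − cA(EA₀ + E₀)) < θ′` (leaf-10's `reach_elim_iff` ∕ `reach_binders_exists` ∕ `smallness_of_gain` — sharp,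
nothing lost), `E₁ := 1`: `∃ C₅, NE5 (B13StepOfRecord.outA S₀ E₀ cB) (B13StepOfRecord.outB S₀ E₀ cB) W κ θ′ C₅` from the displayed binders of
the model of record plus the activity-level W2 binders OVER THE SUB-SLOT.  NOT a proof of NE5. -/
theorem exists_ne5_of_record_restrict_envelope_actNormDecay {W : Set (ℕ → ℝ)} {ROp RHist : ℕ → ℝ}
    {A A' : ℕ → (ℕ → ℝ) → R.carriers.BgB → R.carriers.Dom → InnerLabel R.carriers.Dom (Bnd R) → ℝ}
    {Dt : ActData R.carriers.Dom (InnerLabel R.carriers.Dom (Bnd R)) M Hist Ω}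
    {κ Φ' EA₀ cA c₁ r₀ δ' θ θ' : ℝ}
    (hT : (assembly S₀).TransportReads W)
    (hbB : (assembly S₀).SliceBudgetB W κ cB) (hbA : S₀.D.SliceBudget (step S₀ E₀ cB) W κ cA)
    (hdA : DecayBound (B13StepOfRecord.outA S₀ E₀ cB) W EA₀ κ) (hdB : DecayBound (B13StepOfRecord.outB S₀ E₀ cB) W E₀ κ)
    (hRA : RawBounded S₀.F (assembly S₀).rawAt W) (hRB : RawBounded S₀.F S₀.rawB W)
    (hwer : WeightedEntrywiseRate S₀.F (assembly S₀).rawAt S₀.rawB W c₁ fun k => θ ^ k) (hfl : ∀ k, r₀ ≤ S₀.rOp k)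
    (hins : (step S₀ E₀ cB).InsertionRate W κ E₀ δ' θ)
    (hOp : ∀ k, S₀.rOp k ≤ ROp k) (hHist : ∀ k, (assembly S₀).bHist E₀ cB k + S₀.rHist k ≤ RHist k)
    (hA : ∀ k, ∀ g ∈ W, ∀ (U : R.carriers.BgB) (q : M × Hist),
      q ∈ ballClass (selfCtr (assemblyOn (restrict S₀ M hMA hMB)).raw (assemblyOn (restrict S₀ M hMA hMB)).histRef) ROp RHist k g U →
        ∀ X : R.carriers.Dom, R.carriers.scale X = k → ∀ i : TermIdx R.carriers.Dom (Bnd R),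
          (labelsIndexing (domainGeometry R) (b13InnerData R)).Rel k i X → ∀ m,
            ‖S₀.act ((labelsIndexing (domainGeometry R) (b13InnerData R)).poly i m)
                ((labelsIndexing (domainGeometry R) (b13InnerData R)).lab i m) (q.1 : OpDatum E) q.2‖ ≤
              A k g U ((labelsIndexing (domainGeometry R) (b13InnerData R)).poly i m)
                ((labelsIndexing (domainGeometry R) (b13InnerData R)).lab i m))
    (hA0 : ∀ k g U Z ℓ, 0 ≤ A k g U Z ℓ) (hA0' : ∀ k g U Z ℓ, 0 ≤ A' k g U Z ℓ) (hκ : 0 ≤ κ)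
    (hdec : ∀ k g U Z ℓ, A k g U Z ℓ ≤ A' k g U Z ℓ * Real.exp (-(κ * (R.carriers.d Z + 5))))
    (hΦ0 : 0 ≤ Φ') (hΦsmall : 36 * Φ' < 1)
    (hΦ : ∀ k, ∀ g ∈ W, ∀ (U : R.carriers.BgB) (q : SCube R),
      ∑ Z ∈ R.domAt k, ind (q ∈ footprint Z) * actSum (b13InnerData R) (A' k g U) k Z * Real.exp ((footprint Z).card) ≤ Φ')
    (hact : ActOpLineAnalyticOn (labelsIndexing (domainGeometry R) (b13InnerData R)) (restrict S₀ M hMA hMB).act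
      (ballClass (selfCtr (assemblyOn (restrict S₀ M hMA hMB)).raw (assemblyOn (restrict S₀ M hMA hMB)).histRef) ROp RHist) W)
    (hexp : ActExpLinearOn (labelsIndexing (domainGeometry R) (b13InnerData R)) (restrict S₀ M hMA hMB).act Dt
      (ballClass (selfCtr (assemblyOn (restrict S₀ M hMA hMB)).raw (assemblyOn (restrict S₀ M hMA hMB)).histRef) ROp RHist) W)
    (hE₀ : 0 ≤ E₀) (hcA : 0 ≤ cA) (hcB : 0 ≤ cB) (hc₁ : 0 ≤ c₁) (hr₀ : 0 < r₀) (hδ' : 0 ≤ δ')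
    (hθ0 : 0 < θ) (hθ1 : θ < 1) (hθθ' : θ ≤ θ') (hθ'1 : θ' ≤ 1) (hω : 0 < S₀.D.ω) (hω1 : S₀.D.ω < 1)
    (hh : cA * (EA₀ + E₀) < 1 - S₀.D.ω)
    (hsmall : S₀.D.ω + Φ' / (1 - 36 * Φ') * cA * (1 - S₀.D.ω) / (1 - S₀.D.ω - cA * (EA₀ + E₀)) < θ') :
    ∃ C₅, NE5 (B13StepOfRecord.outA S₀ E₀ cB) (B13StepOfRecord.outB S₀ E₀ cB) W κ θ' C₅ := by
  have hG : 0 ≤ Φ' / (1 - 36 * Φ') := div_nonneg hΦ0 (by linarith)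
  obtain ⟨ρ₀, hreach, hρ₀, hs⟩ := (reach_elim_iff (mul_nonneg hG hcA) hω1).mpr ⟨hh, hsmall⟩
  obtain ⟨k₀, B, hB, hnear, hfirst⟩ :=
    reach_binders_exists (D := c₁ / r₀ + δ') (add_nonneg (div_nonneg hc₁ hr₀.le) hδ') hθ0 hθ1 hreach
  exact ⟨_, ne5_of_record_restrict_envelope_actNormDecay S₀ M hMA hMB E₀ cB hT hbB hbA hdA hdB hRA hRB hwer hfl hins hOp hHist hA hA0
    hA0' hκ hdec hΦ0 hΦsmall hΦ hact hexp hE₀ one_pos hcA hcB hc₁ hr₀ hδ' hθ0.le hθθ' hθ'1 hω hω1 hρ₀ hnear hB hfirst (smallness_of_gain hs)⟩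

/-- [folklore] **THE MOST-REDUCED CAUCHY FACE OF RECORD OVER THE SUB-SLOT** — the letters-eliminated face for the slot package READ AT THE
TRANSPORTED BACKGROUND `readAtSlots S₀ ι` (p212254: the transport reading BY CONSTRUCTION) restricted to `M`:
`∃ C₅, NE5 (outA (readAtSlots S₀ ι) E₀ cB) (outB (readAtSlots S₀ ι) E₀ cB) W κ θ′ C₅` from displayed binders NONE of which is a reading, an
arithmetic letter, an output-level ∕ term-level W2 statement or a geometric side condition — and whose operator-ball binders (`hA`, **`hact`**,
`hexp`) quantify over the sub-slot class in `↥M × Hist` (R20).  This is p214993's `exists_ne5_of_record_envelope_readAt` RE-POINTED. -/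
theorem exists_ne5_of_record_restrict_envelope_readAt (ι : (ℕ → ℝ) → R.carriers.BgA → ℕ → IOp) {W : Set (ℕ → ℝ)} {ROp RHist : ℕ → ℝ}
    {A A' : ℕ → (ℕ → ℝ) → R.carriers.BgB → R.carriers.Dom → InnerLabel R.carriers.Dom (Bnd R) → ℝ}
    {Dt : ActData R.carriers.Dom (InnerLabel R.carriers.Dom (Bnd R)) M Hist Ω} {κ Φ' EA₀ cA c₁ r₀ δ' θ θ' : ℝ}
    (hbB : (assembly (readAtSlots S₀ ι)).SliceBudgetB W κ cB) (hbA : (readAtSlots S₀ ι).D.SliceBudget (step (readAtSlots S₀ ι) E₀ cB) W κ cA)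
    (hdA : DecayBound (B13StepOfRecord.outA (readAtSlots S₀ ι) E₀ cB) W EA₀ κ)
    (hdB : DecayBound (B13StepOfRecord.outB (readAtSlots S₀ ι) E₀ cB) W E₀ κ)
    (hRA : RawBounded S₀.F (assembly S₀).rawAt W) (hRB : RawBounded S₀.F S₀.rawB W)
    (hwer : WeightedEntrywiseRate S₀.F (assembly S₀).rawAt S₀.rawB W c₁ fun k => θ ^ k) (hfl : ∀ k, r₀ ≤ S₀.rOp k)
    (hins : (step (readAtSlots S₀ ι) E₀ cB).InsertionRate W κ E₀ δ' θ)
    (hOp : ∀ k, S₀.rOp k ≤ ROp k) (hHist : ∀ k, (assembly S₀).bHist E₀ cB k + S₀.rHist k ≤ RHist k)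
    (hA : ∀ k, ∀ g ∈ W, ∀ (U : R.carriers.BgB) (q : M × Hist),
      q ∈ ballClass (selfCtr (assemblyOn (restrict (readAtSlots S₀ ι) M hMA hMB)).raw
          (assemblyOn (restrict (readAtSlots S₀ ι) M hMA hMB)).histRef) ROp RHist k g U →
        ∀ X : R.carriers.Dom, R.carriers.scale X = k → ∀ i : TermIdx R.carriers.Dom (Bnd R),
          (labelsIndexing (domainGeometry R) (b13InnerData R)).Rel k i X → ∀ m,
            ‖S₀.act ((labelsIndexing (domainGeometry R) (b13InnerData R)).poly i m)
                ((labelsIndexing (domainGeometry R) (b13InnerData R)).lab i m) (q.1 : OpDatum E) q.2‖ ≤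
              A k g U ((labelsIndexing (domainGeometry R) (b13InnerData R)).poly i m)
                ((labelsIndexing (domainGeometry R) (b13InnerData R)).lab i m))
    (hA0 : ∀ k g U Z ℓ, 0 ≤ A k g U Z ℓ) (hA0' : ∀ k g U Z ℓ, 0 ≤ A' k g U Z ℓ) (hκ : 0 ≤ κ)
    (hdec : ∀ k g U Z ℓ, A k g U Z ℓ ≤ A' k g U Z ℓ * Real.exp (-(κ * (R.carriers.d Z + 5))))
    (hΦ0 : 0 ≤ Φ') (hΦsmall : 36 * Φ' < 1)
    (hΦ : ∀ k, ∀ g ∈ W, ∀ (U : R.carriers.BgB) (q : SCube R),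
      ∑ Z ∈ R.domAt k, ind (q ∈ footprint Z) * actSum (b13InnerData R) (A' k g U) k Z * Real.exp ((footprint Z).card) ≤ Φ')
    (hact : ActOpLineAnalyticOn (labelsIndexing (domainGeometry R) (b13InnerData R)) (restrict (readAtSlots S₀ ι) M hMA hMB).act
      (ballClass (selfCtr (assemblyOn (restrict (readAtSlots S₀ ι) M hMA hMB)).raw
        (assemblyOn (restrict (readAtSlots S₀ ι) M hMA hMB)).histRef) ROp RHist) W)
    (hexp : ActExpLinearOn (labelsIndexing (domainGeometry R) (b13InnerData R)) (restrict (readAtSlots S₀ ι) M hMA hMB).act Dt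
      (ballClass (selfCtr (assemblyOn (restrict (readAtSlots S₀ ι) M hMA hMB)).raw
        (assemblyOn (restrict (readAtSlots S₀ ι) M hMA hMB)).histRef) ROp RHist) W)
    (hE₀ : 0 ≤ E₀) (hcA : 0 ≤ cA) (hcB : 0 ≤ cB) (hc₁ : 0 ≤ c₁) (hr₀ : 0 < r₀) (hδ' : 0 ≤ δ')
    (hθ0 : 0 < θ) (hθ1 : θ < 1) (hθθ' : θ ≤ θ') (hθ'1 : θ' ≤ 1) (hω : 0 < S₀.D.ω) (hω1 : S₀.D.ω < 1)
    (hh : cA * (EA₀ + E₀) < 1 - S₀.D.ω)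
    (hsmall : S₀.D.ω + Φ' / (1 - 36 * Φ') * cA * (1 - S₀.D.ω) / (1 - S₀.D.ω - cA * (EA₀ + E₀)) < θ') :
    ∃ C₅, NE5 (B13StepOfRecord.outA (readAtSlots S₀ ι) E₀ cB) (B13StepOfRecord.outB (readAtSlots S₀ ι) E₀ cB) W κ θ' C₅ :=
  exists_ne5_of_record_restrict_envelope_actNormDecay (readAtSlots S₀ ι) M hMA hMB E₀ cB (transportReads_record_readAt S₀ ι W) hbB hbA
    hdA hdB hRA hRB hwer hfl hins hOp hHist hA hA0 hA0' hκ hdec hΦ0 hΦsmall hΦ hact hexp hE₀ hcA hcB hc₁ hr₀ hδ' hθ0 hθ1 hθθ' hθ'1 hω hω1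
    hh hsmall

end OnSub

end Summit.QuantumFields.BalabanUV.T4Continuum.B13StepEnvelopeEndSub

end
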